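import Mathlib.Algebra.BigOperators.Intervals
import Mathlib.Algebra.BigOperators.Ring.Finset
import Mathlib.Algebra.Order.BigOperators.Group.Finset
import Mathlib.Data.List.GetD
import Mathlib.Tactic.Ring
import Mathlib.Tactic.Linarith
import HarnessLib

/-!
# ω-census family (a): a kernel-checkable BRANCH-AND-BOUND certificate format for integer points of a linear system in a box

Cell `pub-omega` (unit `pub-omega-tensor`, gen 41), topic `Summits/MatrixMultiplication/OmegaCensus` (sub-folder
`SmallFormats`). Framing (verbatim): lottery ticket; floor = certified bounds/negative ranges. HONEST FRAMING: generic bookkeeping (no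
mathematics of matrix multiplication): the certificate format behind this generation's `(9,30)` COVER certificate (every count vector of
the loaded branch of `Enum723.funnel_930` is a group image of `cnt M1` or `cnt M2`). It is the COVERING sibling of tensor g7's
`BoxCertificate` (p259004, namespace `BoxCert`: certificates that every integer point of a box system has `∑ x < T`): here the conclusion is
«every integer point of the box satisfying the rows is one of an explicit list of SOLUTIONS», so the tree has solution leaves besides
Farkas leaves, rows are dense lists, and boxes are explicit digit lists. Nothing here is a bound on any rank; nothing on `ω`.

A SYSTEM is a list of rows `(coefficients : List ℤ, rhs : ℤ)` over variables `x : ℕ → ℕ` indexed by `a < n`, read as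
`∑_{a<n} coeff[a] · x a ≤ rhs`; a BOX is a pair of digit lists `lo, hi` (`lo[a] ≤ x a ≤ hi[a]`). A certificate is a tree:
* `farkas y` — sparse non-negative integer multipliers `y`; the leaf is accepted iff `∑_k y_k rhs_k < ∑_a min (r_a lo_a) (r_a hi_a)` with
  `r = ∑_k y_k row_k` (box form of Farkas' lemma: no real point of the box satisfies the rows);
* `sol` — accepted iff `lo = hi` is one of the listed solution vectors;
* `branch a m l r` — split `x a ≤ m` (certificate `l` on the box with `hi[a] := m`) / `m + 1 ≤ x a` (`r`, `lo[a] := m + 1`).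
`BoxCover.chk_sound`: if the checker accepts, every `x` in the box satisfying the rows agrees on `a < n` with a listed solution.
-/

namespace Summit.MatrixMultiplication.OmegaCensus.SmallFormats.BoxCover

open Finset

/-- Certificate trees. -/
inductive Cert where
  /-- Infeasibility leaf: sparse non-negative multipliers `(row index, value)`. -/
  | farkas (y : List (ℕ × ℕ)) : Cert
  /-- Solution leaf: the box is a point, listed among the solutions. -/
  | sol : Cert
  /-- Split variable `a` at `m`: `x a ≤ m` (left) / `m + 1 ≤ x a` (right). -/
  | branch (a m : ℕ) (l r : Cert) : Cert

/-- `L + y · M` pointwise, keeping the length of `L`. -/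
def axpy : List ℤ → List ℤ → ℤ → List ℤ
  | l :: L, m :: M, y => (l + y * m) :: axpy L M y
  | L, [], _ => L
  | [], _ :: _, _ => []

/-- The combined row `r = r₀ + ∑_k y_k row_k`. -/
def rvec (rows : List (List ℤ × ℤ)) : List (ℕ × ℕ) → List ℤ → List ℤ
  | [], r => r
  | (k, yk) :: ys, r => rvec rows ys (axpy r (rows.getD k ([], 0)).1 yk)

/-- The combined right-hand side `∑_k y_k rhs_k`. -/
def rhsOf (rows : List (List ℤ × ℤ)) : List (ℕ × ℕ) → ℤ
  | [] => 0
  | (k, yk) :: ys => (yk : ℤ) * (rows.getD k ([], 0)).2 + rhsOf rows ys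

/-- `∑_a min (r_a lo_a) (r_a hi_a)` (on the common prefix). -/
def boxMin : List ℤ → List ℕ → List ℕ → ℤ
  | r :: R, l :: L, h :: H => min (r * l) (r * h) + boxMin R L H
  | _, _, _ => 0

/-- **The checker.** -/
def chk (rows : List (List ℤ × ℤ)) (sols : List (List ℕ)) (n : ℕ) : Cert → List ℕ → List ℕ → Bool
  | .farkas y, lo, hi => decide (rhsOf rows y < boxMin (rvec rows y (List.replicate n 0)) lo hi)
  | .sol, lo, hi => decide (lo = hi) && decide (lo ∈ sols)
  | .branch a m l r, lo, hi => chk rows sols n l lo (hi.set a m) && chk rows sols n r (lo.set a (m + 1)) hi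

/-! ## Semantics -/

/-- Value of a row at `x`: `∑_{a<n} coeff[a] · x a`. -/
def rowVal (n : ℕ) (coef : List ℤ) (x : ℕ → ℕ) : ℤ := ∑ a ∈ range n, coef.getD a 0 * (x a : ℤ)

/-- `x` satisfies every row of the system. -/
def Sat (n : ℕ) (rows : List (List ℤ × ℤ)) (x : ℕ → ℕ) : Prop := ∀ k, k < rows.length → rowVal n (rows.getD k ([], 0)).1 x ≤ (rows.getD k ([], 0)).2

/-- `x` lies in the box. -/
def InBox (n : ℕ) (lo hi : List ℕ) (x : ℕ → ℕ) : Prop := ∀ a, a < n → lo.getD a 0 ≤ x a ∧ x a ≤ hi.getD a 0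

/-- `x` agrees with a listed solution on `a < n`. -/
def Listed (n : ℕ) (sols : List (List ℕ)) (x : ℕ → ℕ) : Prop := ∃ v ∈ sols, ∀ a, a < n → x a = v.getD a 0

/-! ## List plumbing -/

/-- `axpy` keeps the length of its first argument. -/
theorem axpy_length : ∀ (L M : List ℤ) (y : ℤ), (axpy L M y).length = L.length
  | [], [], _ => rfl
  | [], _ :: _, _ => rfl
  | _ :: _, [], _ => rfl
  | l :: L, m :: M, y => by simp only [axpy, List.length_cons, axpy_length L M y]

/-- Entries of `axpy`. -/
theorem axpy_getD : ∀ (L M : List ℤ) (y : ℤ) (a : ℕ), a < L.length → (axpy L M y).getD a 0 = L.getD a 0 + y * M.getD a 0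
  | [], _, _, _, h => by simp at h
  | l :: L, [], y, a, _ => by simp [axpy]
  | l :: L, m :: M, y, 0, _ => by simp [axpy]
  | l :: L, m :: M, y, a + 1, h => by
      simp only [axpy, List.getD_cons_succ]
      exact axpy_getD L M y a (by simpa using h)

/-- `rvec` keeps the length. -/
theorem rvec_length (rows : List (List ℤ × ℤ)) : ∀ (ys : List (ℕ × ℕ)) (r : List ℤ), (rvec rows ys r).length = r.length
  | [], _ => rfl
  | (k, yk) :: ys, r => by rw [rvec, rvec_length rows ys, axpy_length]

/-- **The combined row evaluates to the combination of the row values.** -/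
theorem sum_rvec (rows : List (List ℤ × ℤ)) (n : ℕ) (x : ℕ → ℕ) :
    ∀ (ys : List (ℕ × ℕ)) (r : List ℤ), r.length = n →
      ∑ a ∈ range n, (rvec rows ys r).getD a 0 * (x a : ℤ) =
        (∑ a ∈ range n, r.getD a 0 * (x a : ℤ)) + ((ys.map fun e => (e.2 : ℤ) * rowVal n (rows.getD e.1 ([], 0)).1 x).sum)
  | [], r, _ => by simp [rvec]
  | (k, yk) :: ys, r, hr => by
      rw [rvec, sum_rvec rows n x ys _ (by rw [axpy_length, hr]), List.map_cons, List.sum_cons, ← add_assoc]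
      congr 1
      rw [rowVal, Finset.mul_sum, ← Finset.sum_add_distrib]
      refine Finset.sum_congr rfl fun a ha => ?_
      rw [axpy_getD _ _ _ _ (by rw [hr]; exact Finset.mem_range.mp ha)]
      ring

/-- The combined right-hand side is the combination of the right-hand sides. -/
theorem rhsOf_eq (rows : List (List ℤ × ℤ)) :
    ∀ ys : List (ℕ × ℕ), rhsOf rows ys = ((ys.map fun e => (e.2 : ℤ) * (rows.getD e.1 ([], 0)).2).sum)
  | [] => rfl
  | (k, yk) :: ys => by rw [rhsOf, rhsOf_eq rows ys, List.map_cons, List.sum_cons]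

/-- **The box bound**: `boxMin r lo hi ≤ ∑_a r_a x_a` for `x` in the box. -/
theorem boxMin_le : ∀ (r : List ℤ) (lo hi : List ℕ) (x : ℕ → ℕ) (n : ℕ), r.length = n → lo.length = n → hi.length = n →
    InBox n lo hi x → boxMin r lo hi ≤ ∑ a ∈ range n, r.getD a 0 * (x a : ℤ)
  | [], [], [], x, n, hr, _, _, _ => by subst hr; simp [boxMin]
  | r :: R, l :: L, h :: H, x, n, hr, hl, hh, hB => by
      obtain rfl : n = R.length + 1 := by simpa using hr.symm
      simp only [List.length_cons] at hl hh
      rw [boxMin, Finset.sum_range_succ', List.getD_cons_zero]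
      simp only [List.getD_cons_succ]
      have hB' : InBox R.length L H (fun a => x (a + 1)) := fun a ha => by
        have := hB (a + 1) (by omega); simpa using this
      have ih := boxMin_le R L H (fun a => x (a + 1)) R.length rfl (by omega) (by omega) hB'
      have h0 := hB 0 (by omega)
      simp only [List.getD_cons_zero] at h0
      have hmin : min (r * (l : ℤ)) (r * (h : ℤ)) ≤ r * (x 0 : ℤ) := by
        rcases le_or_gt 0 r with hr0 | hr0
        · exact le_trans (min_le_left _ _) (mul_le_mul_of_nonneg_left (by exact_mod_cast h0.1) hr0)
        · exact le_trans (min_le_right _ _) (mul_le_mul_of_nonpos_left (by exact_mod_cast h0.2) hr0.le)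
      rw [add_comm]
      exact add_le_add ih hmin
  | [], [], _ :: _, _, n, hr, _, hh, _ => by subst hr; simp at hh
  | [], _ :: _, _, _, n, hr, hl, _, _ => by subst hr; simp at hl
  | _ :: _, [], _, _, n, hr, hl, _, _ => by subst hr; simp at hl
  | _ :: _, _ :: _, [], _, n, hr, _, hh, _ => by subst hr; simp at hh

/-- Satisfied rows combine with non-negative multipliers. -/
theorem sum_map_le (rows : List (List ℤ × ℤ)) (n : ℕ) (x : ℕ → ℕ) (hS : Sat n rows x) :
    ∀ ys : List (ℕ × ℕ), ((ys.map fun e => (e.2 : ℤ) * rowVal n (rows.getD e.1 ([], 0)).1 x).sum) ≤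
      ((ys.map fun e => (e.2 : ℤ) * (rows.getD e.1 ([], 0)).2).sum)
  | [] => le_rfl
  | (k, yk) :: ys => by
      simp only [List.map_cons, List.sum_cons]
      refine add_le_add ?_ (sum_map_le rows n x hS ys)
      by_cases hk : k < rows.length
      · exact mul_le_mul_of_nonneg_left (hS k hk) (by positivity)
      · rw [List.getD_eq_default _ _ (by omega)]
        simp [rowVal]

/-- Entries of `List.set`. -/
theorem getD_set (l : List ℕ) (a b v : ℕ) (ha : a < l.length) :
    (l.set a v).getD b 0 = if b = a then v else l.getD b 0 := by
  simp only [List.getD_eq_getElem?_getD, List.getElem?_set]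
  split_ifs with h1 h2 h2
  · subst h1; simp
  · exact absurd h1.symm h2
  · exact absurd h2.symm h1
  · rfl

/-! ## Soundness -/

/-- **Soundness of the checker.** If `chk` accepts a certificate on a box (with `n`-entry bound lists), every `x` in the box that
satisfies all rows agrees on `a < n` with one of the listed solutions. -/
theorem chk_sound (rows : List (List ℤ × ℤ)) (sols : List (List ℕ)) (n : ℕ) :
    ∀ (cert : Cert) (lo hi : List ℕ), lo.length = n → hi.length = n → chk rows sols n cert lo hi = true →
      ∀ x : ℕ → ℕ, InBox n lo hi x → Sat n rows x → Listed n sols x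
  | .farkas y, lo, hi, hlo, hhi, h, x, hB, hS => by
      exfalso
      rw [chk, decide_eq_true_eq] at h
      have h1 := boxMin_le (rvec rows y (List.replicate n 0)) lo hi x n (by rw [rvec_length, List.length_replicate]) hlo hhi hB
      rw [sum_rvec rows n x y _ (by simp)] at h1
      have h0 : ∑ a ∈ range n, (List.replicate n (0 : ℤ)).getD a 0 * (x a : ℤ) = 0 :=
        Finset.sum_eq_zero fun a ha => by
          rw [List.getD_eq_getElem?_getD, List.getElem?_replicate]; simp [Finset.mem_range.mp ha]
      rw [h0, zero_add] at h1
      have h2 := sum_map_le rows n x hS y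
      rw [← rhsOf_eq] at h2
      omega
  | .sol, lo, hi, hlo, hhi, h, x, hB, hS => by
      simp only [chk, Bool.and_eq_true, decide_eq_true_eq] at h
      obtain ⟨hlh, hmem⟩ := h
      refine ⟨lo, hmem, fun a ha => ?_⟩
      have := hB a ha; rw [← hlh] at this; omega
  | .branch a m l r, lo, hi, hlo, hhi, h, x, hB, hS => by
      simp only [chk, Bool.and_eq_true] at h
      obtain ⟨hl, hr⟩ := h
      by_cases ha : a < n
      · rcases le_or_gt (x a) m with hx | hx
        · refine chk_sound rows sols n l lo (hi.set a m) hlo (by rw [List.length_set, hhi]) hl x (fun b hb => ?_) hS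
          rw [getD_set _ _ _ _ (by rw [hhi]; exact ha)]
          split_ifs with hba
          · subst hba; exact ⟨(hB b hb).1, hx⟩
          · exact hB b hb
        · refine chk_sound rows sols n r (lo.set a (m + 1)) hi (by rw [List.length_set, hlo]) hhi hr x (fun b hb => ?_) hS
          rw [getD_set _ _ _ _ (by rw [hlo]; exact ha)]
          split_ifs with hba
          · subst hba; exact ⟨by omega, (hB b hb).2⟩
          · exact hB b hb
      · -- splitting a variable outside the range changes nothing
        rw [List.set_eq_of_length_le (by omega)] at hl
        exact chk_sound rows sols n l lo hi hlo hhi hl x hB hS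

/-! ## Covering statements and their combination (for certificates split across files) -/

/-- **The covering property of a box**: every `x` in the box satisfying the rows is listed. -/
def Covers (rows : List (List ℤ × ℤ)) (sols : List (List ℕ)) (n : ℕ) (lo hi : List ℕ) : Prop :=
  ∀ x : ℕ → ℕ, InBox n lo hi x → Sat n rows x → Listed n sols x

/-- An accepted certificate covers its box. -/
theorem covers_of_chk {rows : List (List ℤ × ℤ)} {sols : List (List ℕ)} {n : ℕ} {cert : Cert} {lo hi : List ℕ}
    (hlo : lo.length = n) (hhi : hi.length = n) (h : chk rows sols n cert lo hi = true) : Covers rows sols n lo hi :=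
  chk_sound rows sols n cert lo hi hlo hhi h

/-- **Splitting a box** on variable `a` at `m`: the two halves cover the whole. -/
theorem covers_split {rows : List (List ℤ × ℤ)} {sols : List (List ℕ)} {n : ℕ} {lo hi : List ℕ} (a m : ℕ)
    (hlo : lo.length = n) (hhi : hi.length = n)
    (hl : Covers rows sols n lo (hi.set a m)) (hr : Covers rows sols n (lo.set a (m + 1)) hi) : Covers rows sols n lo hi := by
  intro x hB hS
  by_cases ha : a < n
  · rcases le_or_gt (x a) m with hx | hx
    · refine hl x (fun b hb => ?_) hS
      rw [getD_set _ _ _ _ (by rw [hhi]; exact ha)]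
      split_ifs with hba
      · subst hba; exact ⟨(hB b hb).1, hx⟩
      · exact hB b hb
    · refine hr x (fun b hb => ?_) hS
      rw [getD_set _ _ _ _ (by rw [hlo]; exact ha)]
      split_ifs with hba
      · subst hba; exact ⟨by omega, (hB b hb).2⟩
      · exact hB b hb
  · rw [List.set_eq_of_length_le (by omega)] at hl
    exact hl x hB hS

/-- Monotonicity in the solution list. -/
theorem Listed.mono {n : ℕ} {sols sols' : List (List ℕ)} {x : ℕ → ℕ} (h : Listed n sols x) (hsub : ∀ v ∈ sols, v ∈ sols') :
    Listed n sols' x := by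
  obtain ⟨v, hv, he⟩ := h; exact ⟨v, hsub v hv, he⟩

/-- An empty solution list lists nothing. -/
theorem not_listed_nil {n : ℕ} {x : ℕ → ℕ} : ¬ Listed n [] x := by
  rintro ⟨v, hv, -⟩; simp at hv

end Summit.MatrixMultiplication.OmegaCensus.SmallFormats.BoxCover
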